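import Summits.AtomisticToContinuum.Crystallization.Theorems.ChargedEnergyGapStackingWords
import HarnessLib

/-!
# Charged energy gap — lens-3 g62, part P-S: counting points of a separated reference in a ball (the charging lemma's first input)

Cell `decomp-a2c`, seat lens-3, generation 62, part P-S (after P-R `ChargedEnergyGapStackingWords`).  ELEMENTARY·PROVED, folklore volume packing:
a finite `s`-separated set of points within distance `R` of a centre has at most `((2R + s)/s)³` points (the balls of radius `s/2` about the points are
disjoint and lie in the ball of radius `R + s/2`); hence for an `IsSeparatedRef s` reference `P` the set `P.points ∩ closedBall x R` is FINITE and has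
`ncard ≤ ((2R + s)/s)³`.  This is the space-filling input of the CHARGING LEMMA of memo g62 §2.3 (g63 agenda item 2): near pairs are charged onto
priced excised sites, and the number of reference sites within `3ϱ/8 = 60` of a site is at most `201³` at the record separation `s = 3/5`
(`record_near_ball_count`).
-/

noncomputable section

open scoped Classical

open MeasureTheory
open Literature.MathematicalPhysics.StatisticalMechanics Literature.Geometry.DiscreteGeometry
open Summit.AtomisticToContinuum.Crystallization.Theses.PricedLinkCensus
open Summit.AtomisticToContinuum.Crystallization.Theorems.ChargedEnergyGapNegative

namespace Summit.AtomisticToContinuum.Crystallization.Theorems.ChargedEnergyGapChartDial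

section SeparatedCounting

/-- ★ **VOLUME PACKING COUNT**: a finite `s`-separated set of points of `E3` all within distance `R` of `x` has at most `((2R + s)/s)³` points. -/
theorem card_le_of_separated (T : Finset E3) {s R : ℝ} (hs : 0 < s) (hR : 0 ≤ R) (x : E3)
    (hsep : ∀ p ∈ T, ∀ q ∈ T, p ≠ q → s ≤ dist p q) (hT : ∀ p ∈ T, dist p x ≤ R) :
    (T.card : ℝ) ≤ ((2 * R + s) / s) ^ 3 := by
  have hs2 : (0 : ℝ) ≤ s / 2 := by linarith
  -- the small balls are pairwise disjoint
  have hPD : (↑T : Set E3).PairwiseDisjoint fun p => Metric.ball p (s / 2) := by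
    intro p hp q hq hpq
    exact Metric.ball_disjoint_ball (by linarith [hsep p hp q hq hpq])
  -- and contained in the big ball
  have hcov : (⋃ p ∈ T, Metric.ball p (s / 2)) ⊆ Metric.closedBall x (R + s / 2) := by
    intro z hz
    rw [Set.mem_iUnion₂] at hz
    obtain ⟨p, hp, hz⟩ := hz
    rw [Metric.mem_ball] at hz
    rw [Metric.mem_closedBall]
    linarith [dist_triangle z p x, hT p hp]
  have hvolU : volume (⋃ p ∈ T, Metric.ball p (s / 2)) = ∑ p ∈ T, volume (Metric.ball p (s / 2)) :=
    measure_biUnion_finset hPD fun p _ => measurableSet_ball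
  have hvol : ∑ p ∈ T, volume (Metric.ball p (s / 2)) ≤ volume (Metric.closedBall x (R + s / 2)) := by
    rw [← hvolU]; exact measure_mono hcov
  rw [Finset.sum_congr rfl (fun p _ => Measure.addHaar_ball volume p hs2), Finset.sum_const, nsmul_eq_mul,
    Measure.addHaar_closedBall volume x (by linarith : (0 : ℝ) ≤ R + s / 2), finrank_euclideanSpace_fin, ← mul_assoc] at hvol
  have hV0 : volume (Metric.ball (0 : E3) 1) ≠ 0 := (Metric.measure_ball_pos volume (0 : E3) one_pos).ne'
  have hVt : volume (Metric.ball (0 : E3) 1) ≠ ⊤ := measure_ball_lt_top.ne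
  have hvol' : (T.card : ENNReal) * ENNReal.ofReal ((s / 2) ^ 3) ≤ ENNReal.ofReal ((R + s / 2) ^ 3) :=
    (ENNReal.mul_le_mul_iff_left hV0 hVt).1 hvol
  clear hvol
  have hvol := hvol'
  rw [← ENNReal.ofReal_natCast, ← ENNReal.ofReal_mul (Nat.cast_nonneg _), ENNReal.ofReal_le_ofReal_iff (by positivity)] at hvol
  have hkey : (R + s / 2) ^ 3 = ((2 * R + s) / s) ^ 3 * (s / 2) ^ 3 := by
    rw [← mul_pow]; congr 1; field_simp
  rw [hkey] at hvol
  exact le_of_mul_le_mul_right hvol (by positivity)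

variable {s : ℝ} {P : PeriodicConfiguration 3}

/-- ★ For an `s`-separated reference, finitely many points lie in any closed ball. -/
theorem IsSeparatedRef.finite_inter_closedBall (hP : IsSeparatedRef s P) (hs : 0 < s) (x : E3) (R : ℝ) :
    (P.points ∩ Metric.closedBall x R).Finite := by
  rcases lt_or_ge R 0 with hR | hR
  · rw [Metric.closedBall_eq_empty.2 hR, Set.inter_empty]; exact Set.finite_empty
  by_contra hinf
  obtain ⟨t, ht, hcard⟩ := Set.Infinite.exists_subset_card_eq hinf (⌈((2 * R + s) / s) ^ 3⌉₊ + 1)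
  have hle := card_le_of_separated t hs hR x
    (fun p hp q hq hpq => hP p (ht hp).1 q (ht hq).1 hpq) (fun p hp => Metric.mem_closedBall.1 (ht hp).2)
  rw [hcard] at hle
  have hceil := Nat.le_ceil (((2 * R + s) / s) ^ 3)
  push_cast at hle
  linarith

/-- ★★ **NEAR-BALL COUNT** for an `s`-separated reference: `#(P.points ∩ closedBall x R) ≤ ((2R + s)/s)³`. -/
theorem IsSeparatedRef.ncard_inter_closedBall_le (hP : IsSeparatedRef s P) (hs : 0 < s) {R : ℝ} (hR : 0 ≤ R) (x : E3) :
    ((P.points ∩ Metric.closedBall x R).ncard : ℝ) ≤ ((2 * R + s) / s) ^ 3 := by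
  have hF := hP.finite_inter_closedBall hs x R
  rw [Set.ncard_eq_toFinset_card _ hF]
  refine card_le_of_separated hF.toFinset hs hR x (fun p hp q hq hpq => ?_) (fun p hp => ?_)
  · rw [Set.Finite.mem_toFinset] at hp hq
    exact hP p hp.1 q hq.1 hpq
  · rw [Set.Finite.mem_toFinset] at hp
    exact Metric.mem_closedBall.1 hp.2

/-- The same for a Finset of reference points (the form the charging lemma uses: a finite family of near sites). -/
theorem IsSeparatedRef.card_le (hP : IsSeparatedRef s P) (hs : 0 < s) {R : ℝ} (hR : 0 ≤ R) (x : E3) (T : Finset E3)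
    (hT : ∀ p ∈ T, p ∈ P.points ∧ dist p x ≤ R) : (T.card : ℝ) ≤ ((2 * R + s) / s) ^ 3 :=
  card_le_of_separated T hs hR x (fun p hp q hq hpq => hP p (hT p hp).1 q (hT q hq).1 hpq) fun p hp => (hT p hp).2

/-- RECORD INSTANCE (memo §2.3): at the record separation `s = 3/5` and the near radius `3ϱ/8 = 60` (`ϱ = 160`) a reference has at most
`201³ = 8 120 601` points within `60` of any point; at the second-shell radius `7/5` at most `(17/3)³ < 182`. -/
theorem record_near_ball_count :
    ((2 * 60 + 3 / 5) / (3 / 5) : ℝ) ^ 3 = 8120601 ∧ ((2 * (7 / 5) + 3 / 5) / (3 / 5) : ℝ) ^ 3 < 182 := by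
  norm_num

/-- RECORD COROLLARY: an `IsSeparatedRef (3/5)` reference has at most `8 120 601` points within distance `60` of any point of space. -/
theorem record_near_ball_ncard (hP : IsSeparatedRef (3 / 5) P) (x : E3) :
    ((P.points ∩ Metric.closedBall x 60).ncard : ℝ) ≤ 8120601 := by
  have h := hP.ncard_inter_closedBall_le (by norm_num) (by norm_num : (0 : ℝ) ≤ 60) x
  rw [record_near_ball_count.1] at h
  exact h

end SeparatedCounting

end Summit.AtomisticToContinuum.Crystallization.Theorems.ChargedEnergyGapChartDial
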